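import Summits.AtomisticToContinuum.Crystallization.Theorems.SquareWellLayerCakeGapTwelveToBarlowLinkConesCoverFacets

/-!
# Combinatorial layering (B1a of `GapTwelveToBarlow`): the thick `exists_step` from GoodFacets

Crux `SquareWellLayerCake.GapTwelveToBarlow` (stmt-AtomisticToContinuum-15807), line `Sketch`,
stub `stub_develop` (H_develop), metric closure step (a): GRAPH DISTANCE FROM EUCLIDEAN DISTANCE
needs, at every four-deep Good site `j` and for every direction `u`, a bonded neighbour `l` with
`⟪u, x l − x j⟫ ≥ (2/5)‖u‖` (**H_step**, one line: `SIG_CL_step`).  This file derives H_step from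
**GoodFacets** (the statement of `stub_goodFacets`, verbatim): `0` is interior to the link
polytope (`zero_mem_interior_convexHull_link`), so `u` is a nonnegative combination of at most
three tight link vectors of one facet (`exists_facet_triple`); padded to three distinct tight
sites, GoodFacets gives two bonds among them, i.e. a bonded 2-path `p ~ m ~ q`, and then
`⟪u, x m − x j⟫ ≥ 0.431 (α + β + γ) ≥ 0.431 ‖u‖` since bonded link vectors of norm in `[55/57, 1]`
have inner product `≥ (2 (55/57)² − 1)/2 = 2801/6498` (`inner_ge_of_link_bond`).

* `inner_ge_of_link_bond`, `step_of_two_path` — the estimate;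
* `exists_step_of_goodFacets` (anchor) — `(GoodFacets) → (H_step)`.
Nothing is defined; no named fact is used.
-/

noncomputable section

namespace Summit.AtomisticToContinuum.Crystallization.Theorems.SquareWellLayerCakeGapTwelveToBarlow

open Real RealInnerProductSpace Metric Set Module Finset
open Literature.Geometry.DiscreteGeometry

/-- Two link vectors of norm in `[55/57, 1]` at distance `≤ 1` have inner product
`≥ 2801/6498 = ((55/57)² + (55/57)² − 1)/2`. [folklore] -/
theorem inner_ge_of_link_bond {v w : EuclideanSpace ℝ (Fin 3)} (hv : (55 : ℝ) / 57 ≤ ‖v‖)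
    (hw : (55 : ℝ) / 57 ≤ ‖w‖) (hvw : ‖v - w‖ ≤ 1) : (2801 : ℝ) / 6498 ≤ inner ℝ v w := by
  have hpol : inner ℝ v w = (‖v‖ ^ 2 + ‖w‖ ^ 2 - ‖v - w‖ ^ 2) / 2 := by
    rw [norm_sub_sq_real]; ring
  have h1 : ((55 : ℝ) / 57) ^ 2 ≤ ‖v‖ ^ 2 := pow_le_pow_left₀ (by norm_num) hv 2
  have h2 : ((55 : ℝ) / 57) ^ 2 ≤ ‖w‖ ^ 2 := pow_le_pow_left₀ (by norm_num) hw 2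
  have h3 : ‖v - w‖ ^ 2 ≤ 1 := by
    have := pow_le_pow_left₀ (norm_nonneg _) hvw 2; simpa using this
  rw [hpol]; nlinarith

/-- **The step estimate.**  If `u = α vₚ + β vₘ + γ v_q` with nonnegative coefficients over three
link vectors of norm in `[55/57, 1]`, the middle one bonded to the other two
(`‖vₚ − vₘ‖, ‖v_q − vₘ‖ ≤ 1`), then `⟪u, vₘ⟫ ≥ (2/5)‖u‖`. [folklore] -/
theorem step_of_two_path {u vp vm vq : EuclideanSpace ℝ (Fin 3)} {α β γ : ℝ} (hα : 0 ≤ α)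
    (hβ : 0 ≤ β) (hγ : 0 ≤ γ) (hu : u = α • vp + β • vm + γ • vq)
    (hp0 : (55 : ℝ) / 57 ≤ ‖vp‖) (hp1 : ‖vp‖ ≤ 1) (hm0 : (55 : ℝ) / 57 ≤ ‖vm‖) (hm1 : ‖vm‖ ≤ 1)
    (hq0 : (55 : ℝ) / 57 ≤ ‖vq‖) (hq1 : ‖vq‖ ≤ 1) (hpm : ‖vp - vm‖ ≤ 1) (hqm : ‖vq - vm‖ ≤ 1) :
    2 / 5 * ‖u‖ ≤ inner ℝ u vm := by
  have hip := inner_ge_of_link_bond hp0 hm0 hpm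
  have hiq := inner_ge_of_link_bond hq0 hm0 hqm
  have him : (2801 : ℝ) / 6498 ≤ inner ℝ vm vm := by
    rw [real_inner_self_eq_norm_sq]; nlinarith
  have hnorm : ‖u‖ ≤ α + β + γ := by
    rw [hu]
    calc ‖α • vp + β • vm + γ • vq‖ ≤ ‖α • vp‖ + ‖β • vm‖ + ‖γ • vq‖ := norm_add₃_le
      _ = α * ‖vp‖ + β * ‖vm‖ + γ * ‖vq‖ := by
        rw [norm_smul, norm_smul, norm_smul, Real.norm_of_nonneg hα, Real.norm_of_nonneg hβ,
          Real.norm_of_nonneg hγ]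
      _ ≤ α + β + γ := by nlinarith
  have hinner : inner ℝ u vm = α * inner ℝ vp vm + β * inner ℝ vm vm + γ * inner ℝ vq vm := by
    rw [hu, inner_add_left, inner_add_left, real_inner_smul_left, real_inner_smul_left,
      real_inner_smul_left]
  rw [hinner]
  nlinarith [mul_le_mul_of_nonneg_left hip hα, mul_le_mul_of_nonneg_left him hβ,
    mul_le_mul_of_nonneg_left hiq hγ]

/-- **H_step from GoodFacets** (anchor of this file): at a four-deep Good site every direction
`u` has a bonded neighbour `l` with `⟪u, x l − x j⟫ ≥ (2/5)‖u‖`. [folklore] -/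
theorem exists_step_of_goodFacets :
    (∀ (N : ℕ) (x : Fin N → EuclideanSpace ℝ (Fin 3)) (i : Fin N), (∀ l : Fin N, dist (x i) (x
    l) ≤ 4 → ((∀ j' : Fin N, dist (x l) (x j') ≤ 11 / 10 → ∀ k : Fin N, k ≠ j' → (55 : ℝ) / 57 ≤
    dist (x j') (x k)) ∧ (Finset.univ.filter fun j' : Fin N => j' ≠ l ∧ dist (x l) (x j') ≤
    1).card = 12 ∧ (Finset.univ.filter fun j' : Fin N => j' ≠ l ∧ dist (x l) (x j') ≤ 11 /
    10).card ≤ 12)) → ∀ (n : EuclideanSpace ℝ (Fin 3)) (a b c : Fin N), (∀ l : Fin N, l ≠ i →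
    dist (x i) (x l) ≤ 1 → inner ℝ n (x l - x i) ≤ 1) → a ≠ i → b ≠ i → c ≠ i → a ≠ b → b ≠ c →
    a ≠ c → dist (x i) (x a) ≤ 1 → dist (x i) (x b) ≤ 1 → dist (x i) (x c) ≤ 1 → inner ℝ n (x a
    - x i) = 1 → inner ℝ n (x b - x i) = 1 → inner ℝ n (x c - x i) = 1 → (dist (x a) (x b) ≤ 1 ∧
    dist (x b) (x c) ≤ 1) ∨ (dist (x b) (x c) ≤ 1 ∧ dist (x c) (x a) ≤ 1) ∨ (dist (x c) (x a) ≤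
    1 ∧ dist (x a) (x b) ≤ 1)) → ∀ (N : ℕ) (x : Fin N → EuclideanSpace ℝ (Fin 3)) (j : Fin N),
    (∀ l : Fin N, dist (x j) (x l) ≤ 4 → ((∀ j' : Fin N, dist (x l) (x j') ≤ 11 / 10 → ∀ k : Fin
    N, k ≠ j' → (55 : ℝ) / 57 ≤ dist (x j') (x k)) ∧ (Finset.univ.filter fun j' : Fin N => j' ≠
    l ∧ dist (x l) (x j') ≤ 1).card = 12 ∧ (Finset.univ.filter fun j' : Fin N => j' ≠ l ∧ dist
    (x l) (x j') ≤ 11 / 10).card ≤ 12)) → ∀ u : EuclideanSpace ℝ (Fin 3), ∃ l : Fin N, l ≠ j ∧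
    dist (x j) (x l) ≤ 1 ∧ (2 / 5) * ‖u‖ ≤ inner ℝ u (x l - x j) :=
  by
  intro hGF N x i hgood u
  classical
  obtain ⟨hsep, hcard, -⟩ := hgood i (by rw [dist_self]; norm_num)
  -- the link `L` and its vectors `X`
  set L : Finset (Fin N) := Finset.univ.filter fun l : Fin N => l ≠ i ∧ dist (x i) (x l) ≤ 1
    with hL
  have hmemL : ∀ l, l ∈ L ↔ l ≠ i ∧ dist (x i) (x l) ≤ 1 := fun l => by
    rw [hL, Finset.mem_filter]; exact ⟨fun h => h.2, fun h => ⟨Finset.mem_univ _, h⟩⟩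
  have hsepL : ∀ l ∈ L, ∀ k : Fin N, k ≠ l → (55 : ℝ) / 57 ≤ dist (x l) (x k) :=
    fun l hl k hk => hsep l (by linarith [((hmemL l).1 hl).2]) k hk
  -- `u = 0`: any neighbour will do
  by_cases hu0 : u = 0
  · have hne : L.Nonempty := by rw [← Finset.card_pos, hcard]; norm_num
    obtain ⟨l, hl⟩ := hne
    exact ⟨l, ((hmemL l).1 hl).1, ((hmemL l).1 hl).2, by rw [hu0, norm_zero, inner_zero_left]; norm_num⟩
  set X : Finset (EuclideanSpace ℝ (Fin 3)) := L.image fun l => x l - x i with hX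
  have hinj : Set.InjOn (fun l => x l - x i) ↑L := by
    intro l hl l' hl' h
    by_contra hne
    have h55 := hsepL l (Finset.mem_coe.1 hl) l' (Ne.symm hne)
    have : x l = x l' := sub_left_injective h
    rw [dist_eq_norm, this, sub_self, norm_zero] at h55
    norm_num at h55
  have hXcard : X.card = 12 := by rw [hX, Finset.card_image_of_injOn hinj]; exact hcard
  have hX1 : ∀ v ∈ X, ‖v‖ ≤ 1 := by
    intro v hv
    obtain ⟨l, hl, rfl⟩ := Finset.mem_image.1 hv
    rw [← dist_eq_norm, dist_comm]; exact ((hmemL l).1 hl).2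
  have hX0 : ∀ v ∈ X, (55 : ℝ) / 57 ≤ ‖v‖ := by
    intro v hv
    obtain ⟨l, hl, rfl⟩ := Finset.mem_image.1 hv
    rw [← dist_eq_norm, dist_comm]
    exact hsep i (by rw [dist_self]; norm_num) l ((hmemL l).1 hl).1
  have hXsep : ∀ v ∈ X, ∀ w ∈ X, v ≠ w → (55 : ℝ) / 57 ≤ ‖v - w‖ := by
    intro v hv w hw hvw
    obtain ⟨l, hl, rfl⟩ := Finset.mem_image.1 hv
    obtain ⟨l', hl', rfl⟩ := Finset.mem_image.1 hw
    have hne : l' ≠ l := fun h => hvw (by rw [h])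
    rw [sub_sub_sub_cancel_right, ← dist_eq_norm]
    exact hsepL l hl l' hne
  have h0 := zero_mem_interior_convexHull_link hXcard hX1 hX0 hXsep
  -- the facet of `u` and a Carathéodory triple on it
  obtain ⟨c, hc, t, hts, htcard, w, hw0, hyw⟩ := exists_facet_triple h0 u
  have hvalid : ∀ l : Fin N, l ≠ i → dist (x i) (x l) ≤ 1 → inner ℝ c (x l - x i) ≤ 1 :=
    fun l hl hdl =>
      (mem_facetNormals.1 hc).1 _ (Finset.mem_image.2 ⟨l, (hmemL l).2 ⟨hl, hdl⟩, rfl⟩)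
  have htight : ∀ z ∈ tightSet X c, ∃ l : Fin N, (l ≠ i ∧ dist (x i) (x l) ≤ 1) ∧
      inner ℝ c (x l - x i) = 1 ∧ x l - x i = z := by
    intro z hz
    obtain ⟨hzX, hz1⟩ := mem_tightSet.1 hz
    obtain ⟨l, hl, rfl⟩ := Finset.mem_image.1 hzX
    exact ⟨l, (hmemL l).1 hl, hz1, rfl⟩
  -- norms of link vectors
  have hn0 : ∀ l : Fin N, l ≠ i → (55 : ℝ) / 57 ≤ ‖x l - x i‖ := fun l hl => by
    rw [← dist_eq_norm, dist_comm]; exact hsep i (by rw [dist_self]; norm_num) l hl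
  have hn1 : ∀ l : Fin N, dist (x i) (x l) ≤ 1 → ‖x l - x i‖ ≤ 1 := fun l hl => by
    rw [← dist_eq_norm, dist_comm]; exact hl
  have hbnd : ∀ l l' : Fin N, dist (x l) (x l') ≤ 1 → ‖(x l - x i) - (x l' - x i)‖ ≤ 1 :=
    fun l l' h => by rw [sub_sub_sub_cancel_right, ← dist_eq_norm]; exact h
  -- three distinct tight points carrying `u` in their cone suffice
  have key : ∀ a b d : EuclideanSpace ℝ (Fin 3), a ∈ tightSet X c → b ∈ tightSet X c →
      d ∈ tightSet X c → a ≠ b → b ≠ d → a ≠ d → ∀ α β γ : ℝ, 0 ≤ α → 0 ≤ β → 0 ≤ γ →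
      u = α • a + β • b + γ • d →
      ∃ l : Fin N, l ≠ i ∧ dist (x i) (x l) ≤ 1 ∧ 2 / 5 * ‖u‖ ≤ inner ℝ u (x l - x i) := by
    intro a b d ha hb hd hab hbd had α β γ hα hβ hγ hy
    obtain ⟨la, hla, hla1, rfl⟩ := htight a ha
    obtain ⟨lb, hlb, hlb1, rfl⟩ := htight b hb
    obtain ⟨ld, hld, hld1, rfl⟩ := htight d hd
    have hab' : la ≠ lb := fun h => hab (by rw [h])
    have hbd' : lb ≠ ld := fun h => hbd (by rw [h])
    have had' : la ≠ ld := fun h => had (by rw [h])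
    rcases hGF N x i hgood c la lb ld hvalid hla.1 hlb.1 hld.1 hab' hbd' had' hla.2 hlb.2 hld.2
      hla1 hlb1 hld1 with ⟨h1, h2⟩ | ⟨h1, h2⟩ | ⟨h1, h2⟩
    · -- middle `lb`
      refine ⟨lb, hlb.1, hlb.2, step_of_two_path hα hβ hγ hy (hn0 la hla.1) (hn1 la hla.2)
        (hn0 lb hlb.1) (hn1 lb hlb.2) (hn0 ld hld.1) (hn1 ld hld.2) (hbnd la lb h1) ?_⟩
      rw [dist_comm] at h2; exact hbnd ld lb h2
    · -- middle `ld`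
      refine ⟨ld, hld.1, hld.2, step_of_two_path hβ hγ hα (by rw [hy]; abel) (hn0 lb hlb.1)
        (hn1 lb hlb.2) (hn0 ld hld.1) (hn1 ld hld.2) (hn0 la hla.1) (hn1 la hla.2) (hbnd lb ld h1) ?_⟩
      rw [dist_comm] at h2; exact hbnd la ld h2
    · -- middle `la`
      refine ⟨la, hla.1, hla.2, step_of_two_path hγ hα hβ (by rw [hy]; abel) (hn0 ld hld.1)
        (hn1 ld hld.2) (hn0 la hla.1) (hn1 la hla.2) (hn0 lb hlb.1) (hn1 lb hlb.2) (hbnd ld la h1) ?_⟩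
      rw [dist_comm] at h2; exact hbnd lb la h2
  -- a facet has at least three tight points
  have hthree : 3 ≤ (tightSet X c).card := by
    have := (mem_facetNormals.1 hc).finrank_le_card
    rwa [finrank_euclideanSpace_fin] at this
  -- case analysis on the size of the Carathéodory set
  rcases Nat.lt_or_ge t.card 1 with h0t | h1t
  · have ht : t = ∅ := Finset.card_eq_zero.1 (by omega)
    rw [ht, Finset.sum_empty] at hyw
    exact absurd hyw hu0
  rcases Nat.lt_or_ge t.card 2 with h2t | h2t
  · -- `t = {a}`: add two tight points
    obtain ⟨a, rfl⟩ := (Finset.card_eq_one (s := t)).1 (by omega)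
    rw [Finset.sum_singleton] at hyw
    have ha := hts (Finset.mem_singleton_self a)
    obtain ⟨b, hb, hbt⟩ := Finset.exists_mem_notMem_of_card_lt_card
      (by rw [Finset.card_singleton]; omega : ({a} : Finset _).card < (tightSet X c).card)
    have hba : b ≠ a := fun h => hbt (by rw [h]; exact Finset.mem_singleton_self _)
    obtain ⟨d, hd, hdt⟩ := Finset.exists_mem_notMem_of_card_lt_card
      (by rw [Finset.card_pair hba.symm]; omega : ({a, b} : Finset _).card < (tightSet X c).card)
    have hda : d ≠ a := fun h => hdt (by rw [h]; exact Finset.mem_insert_self _ _)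
    have hdb : d ≠ b := fun h =>
      hdt (by rw [h]; exact Finset.mem_insert_of_mem (Finset.mem_singleton_self _))
    exact key a b d ha hb hd hba.symm hdb.symm hda.symm (w a) 0 0
      (hw0 a (Finset.mem_singleton_self a)) le_rfl le_rfl (by rw [hyw, zero_smul, zero_smul, add_zero, add_zero])
  rcases Nat.lt_or_ge t.card 3 with h3t | h3t
  · -- `t = {a, b}`: add a third tight point
    obtain ⟨a, b, hab, rfl⟩ := (Finset.card_eq_two (s := t)).1 (by omega)
    obtain ⟨d, hd, hdt⟩ := Finset.exists_mem_notMem_of_card_lt_card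
      (by omega : ({a, b} : Finset _).card < (tightSet X c).card)
    have hda : d ≠ a := fun h => hdt (by rw [h]; exact Finset.mem_insert_self _ _)
    have hdb : d ≠ b := fun h =>
      hdt (by rw [h]; exact Finset.mem_insert_of_mem (Finset.mem_singleton_self _))
    rw [Finset.sum_pair hab] at hyw
    exact key a b d (hts (Finset.mem_insert_self _ _))
      (hts (Finset.mem_insert_of_mem (Finset.mem_singleton_self _))) hd hab hdb.symm hda.symm
      (w a) (w b) 0 (hw0 a (Finset.mem_insert_self _ _))
      (hw0 b (Finset.mem_insert_of_mem (Finset.mem_singleton_self _))) le_rfl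
      (by rw [hyw, zero_smul, add_zero])
  · -- `t = {a, b, d}`
    obtain ⟨a, b, d, hab, had, hbd, rfl⟩ := (Finset.card_eq_three (s := t)).1 (by omega)
    have ha : a ∈ ({a, b, d} : Finset _) := Finset.mem_insert_self _ _
    have hb : b ∈ ({a, b, d} : Finset _) :=
      Finset.mem_insert_of_mem (Finset.mem_insert_self _ _)
    have hd : d ∈ ({a, b, d} : Finset _) :=
      Finset.mem_insert_of_mem (Finset.mem_insert_of_mem (Finset.mem_singleton_self _))
    rw [Finset.sum_insert (by simp [hab, had]), Finset.sum_pair hbd] at hyw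
    exact key a b d (hts ha) (hts hb) (hts hd) hab hbd had (w a) (w b) (w d) (hw0 a ha)
      (hw0 b hb) (hw0 d hd) (by rw [hyw, add_assoc])

end Summit.AtomisticToContinuum.Crystallization.Theorems.SquareWellLayerCakeGapTwelveToBarlow
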